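import Literature.NumberTheory.EllipticCurves.SerreOpenImageAssemblyProofs
import Literature.NumberTheory.EllipticCurves.ComplexMultiplicationHasCMProofs
import Literature.NumberTheory.EllipticCurves.GlobalMinimalModelProofs
import HarnessLib

/-!
# Serre's open image theorem over `ℚ` (`serre_open_image`) from the local input of §1.11 and the
# density `0` of the supersingular primes

Topic `NumberTheory/EllipticCurves`.  Theorems only (nothing is defined, no named fact).  The
named fact `Literature.NumberTheory.EllipticCurves.serre_open_image` (J.-P. Serre, Invent. Math. 15
(1972), §4.2, Théorème 2, for `K = ℚ`) quantifies over *all* elliptic Weierstrass curves over `ℚ`;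
`SerreOpenImageAssemblyProofs` proves it for curves in global minimal form, conditionally on the
local input `hF` (§1.11: Prop. 11 with Cor., Prop. 12 c)) and on the density-`0` statement
`serre_supersingular_density_zero`.  This file removes the minimality restriction: every `E/ℚ` has
a global minimal model `C • W` (the tree's theorem `hasGlobalMinimalModel_rat_holds`, Néron /
Silverman VIII.8.3), complex multiplication is invariant under `ℚ`-isomorphism
(`HasCM.of_variableChange_baseChange`), and so is the surjectivity of `ρ̄_{E,n}`
(`hasSurjectiveModNGaloisRep_of_isogeny_bijective`, transport along the `Γ_ℚ`-equivariant group
isomorphism `E(ℚ̄) ≃ (C • E)(ℚ̄)`, `VariableChange.toIsogeny`).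

* `WeierstrassCurve.hasSurjectiveModNGaloisRep_of_isogeny_bijective` — a bijective isogeny
  identifies the Galois modules `E[n] ≅ E'[n]`, so `ρ̄_{E',n}` onto implies `ρ̄_{E,n}` onto.
* `Literature.NumberTheory.EllipticCurves.serre_open_image_of_inertia_shape` — **`serre_open_image`
  from `hF` (for globally minimal curves) and `serre_supersingular_density_zero`.**
* `WeierstrassCurve.exists_mem_inertia_smul_eq_of_sub_mem_line` — in the ordinary alternative of
  `hF` the clause "`χ_X : I → 𝔽_ℓˣ` is onto" is *automatic* over `ℚ`: if every `τ ∈ I_𝔏` acts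
  trivially on `E[ℓ]/𝔽_ℓ v₀` then `τ v₀ = det ρ̄(τ) v₀ = χ̄_ℓ(τ) v₀` (Weil pairing), and `χ̄_ℓ` maps
  the absolute inertia group at `ℓ` onto `𝔽_ℓˣ` (`exists_mem_inertia_modNCyclotomicCharacter_eq`,
  `ℚ(ζ_ℓ)/ℚ` totally ramified at `ℓ`) — exactly Serre's proof of Prop. 11
  ("`χ_X χ_Y = θ_{p-1}^e`").  Whence the final form
  `Literature.NumberTheory.EllipticCurves.serre_open_image_of_reduction_shape`, whose local
  hypothesis only asks, at a good `ℓ`, for a non-zero `v₀ ∈ E[ℓ]` with `(τ - 1) E[ℓ] ⊆ 𝔽_ℓ v₀`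
  for all `τ ∈ I_𝔏` (ordinary: the kernel of reduction, inertia acting trivially on `Ẽ[ℓ]`), or
  for the image of `I_𝔏` to be cyclic of order `ℓ² - 1` (supersingular, Prop. 12 c)).

## References

* [Serre1972] J.-P. Serre, Invent. Math. 15 (1972) 259–331, §4.2, Théorème 2; §1.11.
* [SilvermanAEC2009] J. H. Silverman, *The Arithmetic of Elliptic Curves*, 2nd ed., VIII.8.3,
  III.3.1(b).
-/

noncomputable section

open scoped Classical NumberField Matrix
open IsDedekindDomain Field

namespace WeierstrassCurve

open Literature.NumberTheory.EllipticCurves Literature.NumberTheory.GaloisRepresentations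
  Literature.NumberTheory.GaloisRepresentations.Serre1972 Rat.HeightOneSpectrum

/-- **Surjectivity of `ρ̄_{E,n}` is invariant under bijective isogenies** (in particular under
`K`-isomorphisms `E ≅ C • E`): a `Γ_K`-equivariant group isomorphism `κ : E(K̄) → E'(K̄)`
restricts to an isomorphism of Galois modules `E[n] ≅ E'[n]`, which conjugates `ρ̄_{E,n}` into
`ρ̄_{E',n}`. [folklore] -/
theorem hasSurjectiveModNGaloisRep_of_isogeny_bijective {K : Type*} [Field K]
    {W W' : WeierstrassCurve K} (κ : Isogeny W W') (hκ : Function.Bijective κ) (n : ℤ)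
    (h : W'.HasSurjectiveModNGaloisRep n) : W.HasSurjectiveModNGaloisRep n := by
  -- the restriction `ε : E[n] ≃+ E'[n]`
  have hmem : ∀ P : geomTorsion W n, κ (P : W.geomPoints) ∈ geomTorsion W' n := fun P ↦ by
    have hP : n • (P : W.geomPoints) = 0 := (Submodule.mem_torsionBy_iff n _).mp P.2
    refine (Submodule.mem_torsionBy_iff n _).mpr ?_
    rw [← map_zsmul, hP, map_zero]
  let f : geomTorsion W n → geomTorsion W' n := fun P ↦ ⟨κ (P : W.geomPoints), hmem P⟩
  have hf : Function.Bijective f := by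
    constructor
    · intro P Q hPQ
      exact Subtype.ext (hκ.1 (congrArg Subtype.val hPQ))
    · intro Q
      obtain ⟨P, hP⟩ := hκ.2 (Q : W'.geomPoints)
      have hPn : P ∈ geomTorsion W n := by
        refine (Submodule.mem_torsionBy_iff n _).mpr (hκ.1 ?_)
        have hQ : n • (Q : W'.geomPoints) = 0 := (Submodule.mem_torsionBy_iff n _).mp Q.2
        rw [map_zsmul, hP, hQ, map_zero]
      exact ⟨⟨P, hPn⟩, Subtype.ext hP⟩
  let f' : geomTorsion W n →+ geomTorsion W' n :=
    { toFun := f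
      map_zero' := Subtype.ext (map_zero κ)
      map_add' := fun P Q ↦ Subtype.ext (map_add κ (P : W.geomPoints) (Q : W.geomPoints)) }
  let ε : geomTorsion W n ≃+ geomTorsion W' n := AddEquiv.ofBijective f' hf
  have hε : ∀ P : geomTorsion W n,
      ((ε P : geomTorsion W' n) : W'.geomPoints) = κ (P : W.geomPoints) := fun P ↦ rfl
  have hεsmul : ∀ (σ : absoluteGaloisGroup K) (P : geomTorsion W n), ε (σ • P) = σ • ε P := by
    intro σ P
    apply Subtype.ext
    rw [hε, AddSubgroup.torsionBy.coe_smul, κ.map_smul, AddSubgroup.torsionBy.coe_smul, hε]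
  -- conjugate and lift
  intro g
  set g' : AddAut (geomTorsion W' n) := ε.symm.trans ((Multiplicative.toAdd g).trans ε) with hg'
  obtain ⟨σ, hσ⟩ := h (Multiplicative.ofAdd g')
  refine ⟨σ, ?_⟩
  apply Multiplicative.toAdd.injective
  refine AddEquiv.ext fun P ↦ ε.injective ?_
  have h1 : Multiplicative.toAdd (galoisRepTorsion W' n σ) (ε P) = σ • ε P := rfl
  have h2 : Multiplicative.toAdd (galoisRepTorsion W n σ) P = σ • P := rfl
  rw [h2, hεsmul, ← h1, hσ, toAdd_ofAdd, hg', AddEquiv.trans_apply, AddEquiv.trans_apply,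
    AddEquiv.symm_apply_apply]

/-! ### The character on the line is onto: `χ_X = det = χ̄_ℓ` on inertia -/

/-- A `2 × 2` matrix acting trivially on `F²/F v` (`g w - w ∈ F v` for all `w`) and by `c` on
`v ≠ 0` has determinant `c` (in a basis `(w, v)` it is `(1 0; b c)`). [folklore] -/
theorem _root_.Literature.NumberTheory.EllipticCurves.det_eq_of_sub_mem_line {F : Type*} [Field F]
    {g : Matrix (Fin 2) (Fin 2) F} {v : Fin 2 → F} (hv : v ≠ 0) {c : F}
    (hgv : g *ᵥ v = c • v) (hquot : ∀ w : Fin 2 → F, ∃ b : F, g *ᵥ w - w = b • v) :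
    g.det = c := by
  obtain ⟨w, hw⟩ := exists_det_cols_ne_zero hv
  obtain ⟨b, hb⟩ := hquot w
  have hgw : g *ᵥ w = w + b • v := by rw [← hb, add_sub_cancel]
  -- `g P = P M` with `P = (w | v)` and `M = (1 0; b c)`
  have hPdet : (!![w 0, v 0; w 1, v 1] : Matrix (Fin 2) (Fin 2) F).det ≠ 0 := by
    rw [Matrix.det_fin_two_of]
    intro h
    apply hw
    linear_combination -h
  have hgP : g * !![w 0, v 0; w 1, v 1] = !![w 0, v 0; w 1, v 1] * !![1, 0; b, c] := by
    rw [mul_cols, hgw, hgv]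
    ext i j
    fin_cases i <;> fin_cases j <;> simp [Matrix.mul_apply, Fin.sum_univ_two, mul_comm]
  have h := congrArg Matrix.det hgP
  have hM : (!![1, 0; b, c] : Matrix (Fin 2) (Fin 2) F).det = c := by
    rw [Matrix.det_fin_two_of]; ring
  rw [Matrix.det_mul, Matrix.det_mul, hM, mul_comm _ c] at h
  exact mul_right_cancel₀ hPdet h

/-- **Serre 1972, §1.11, proof of Prop. 11 ("`χ_X χ_Y = det = θ_{p-1}^e`"), over `ℚ`.**  Let
`E = W/ℚ` be an elliptic curve, `ℓ` a prime, `𝔏` a prime of `\bar ℤ` above `ℓ` with inertia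
group `I = I_𝔏 ≤ Γ_ℚ`, and `v₀ ∈ E[ℓ] ∖ 0` such that every `τ ∈ I` acts trivially on
`E[ℓ]/𝔽_ℓ v₀` (`τ x - x ∈ 𝔽_ℓ v₀`).  Then the character of `I` on the line `𝔽_ℓ v₀` is onto
`𝔽_ℓˣ`: `τ v₀ = det ρ̄_{E,ℓ}(τ) v₀ = χ̄_ℓ(τ) v₀` by the Weil pairing
(`det_frame_galoisRepTorsion_eq`), and `χ̄_ℓ(I_𝔏) = 𝔽_ℓˣ` because `ℚ(ζ_ℓ)` is totally ramified
at `ℓ` (`exists_mem_inertia_modNCyclotomicCharacter_eq`).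
[cite: Serre1972, §1.11, Prop. 11 and Cor. (a)] -/
theorem exists_mem_inertia_smul_eq_of_sub_mem_line (W : WeierstrassCurve ℚ) [W.IsElliptic]
    (ℓ : ℕ) [Fact ℓ.Prime] {v : HeightOneSpectrum (𝓞 ℚ)} (hv : (primesEquiv v : ℕ) = ℓ)
    {𝔓 : Ideal (absIntegers (𝓞 ℚ) ℚ)} (h𝔓 : 𝔓 ∈ v.primesAbove) {v₀ : geomTorsion W ℓ}
    (hv₀ : v₀ ≠ 0)
    (hquot : letI : Module (ZMod ℓ) (geomTorsion W ℓ) := AddSubgroup.torsionBy.zmodModule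
      ∀ τ ∈ 𝔓.inertia (absoluteGaloisGroup ℚ), ∀ x : geomTorsion W ℓ,
        ∃ b : ZMod ℓ, τ • x - x = b • v₀) (a : (ZMod ℓ)ˣ) :
    letI : Module (ZMod ℓ) (geomTorsion W ℓ) := AddSubgroup.torsionBy.zmodModule
    ∃ τ ∈ 𝔓.inertia (absoluteGaloisGroup ℚ), τ • v₀ = (a : ZMod ℓ) • v₀ := by
  letI : Module (ZMod ℓ) (geomTorsion W ℓ) := AddSubgroup.torsionBy.zmodModule
  have hp : ℓ.Prime := Fact.out
  haveI : NeZero ℓ := ⟨hp.ne_zero⟩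
  -- an inertia element with `χ̄_ℓ(τ) = a`
  obtain ⟨τ, hτ, hτa⟩ := exists_mem_inertia_modNCyclotomicCharacter_eq (m := ℓ) (p := ℓ) (k := 0)
    (d := 1) (by rw [zero_add, pow_one, mul_one]) hp.not_dvd_one hv h𝔓 (a := a)
    (Subsingleton.elim _ _)
  refine ⟨τ, hτ, ?_⟩
  -- in a frame: `det Φ(ρ̄ τ) = χ̄_ℓ(τ) = a`, and `Φ(ρ̄ τ)` is `(1 0; b c)` with `τ v₀ = c v₀`
  obtain ⟨e, Φ, he, -, -, -, -⟩ := exists_frame_galoisRepTorsion_rat W ℓ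
  obtain ⟨b₀, hb₀⟩ := hquot τ hτ v₀
  set c : ZMod ℓ := 1 + b₀ with hc
  have hτv : τ • v₀ = c • v₀ := by rw [hc, add_smul, one_smul, ← hb₀, add_sub_cancel]
  suffices hca : c = (a : ZMod ℓ) by rw [hτv, hca]
  have hev₀ : e v₀ ≠ 0 := fun h0 ↦ hv₀ (e.injective (h0.trans (map_zero e).symm))
  have hg : ((Φ (galoisRepTorsion W ℓ τ) : GL (Fin 2) (ZMod ℓ)) :
      Matrix (Fin 2) (Fin 2) (ZMod ℓ)) *ᵥ e v₀ = c • e v₀ := by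
    rw [← he, ← ZMod.map_smul e c v₀, ← hτv]
    rfl
  have hgq : ∀ w : Fin 2 → ZMod ℓ, ∃ b : ZMod ℓ, ((Φ (galoisRepTorsion W ℓ τ) :
      GL (Fin 2) (ZMod ℓ)) : Matrix (Fin 2) (Fin 2) (ZMod ℓ)) *ᵥ w - w = b • e v₀ := by
    intro w
    obtain ⟨b, hb⟩ := hquot τ hτ (e.symm w)
    refine ⟨b, ?_⟩
    have h1 := congrArg e hb
    rw [map_sub, ZMod.map_smul e b v₀, AddEquiv.apply_symm_apply] at h1
    have h2 : e (τ • e.symm w) = ((Φ (galoisRepTorsion W ℓ τ) : GL (Fin 2) (ZMod ℓ)) :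
        Matrix (Fin 2) (Fin 2) (ZMod ℓ)) *ᵥ w := by
      rw [show τ • e.symm w = Multiplicative.toAdd (galoisRepTorsion W ℓ τ) (e.symm w) from rfl, he,
        AddEquiv.apply_symm_apply]
    rw [← h1, h2]
  have h1 := det_eq_of_sub_mem_line hev₀ hg hgq
  rw [← h1, det_frame_galoisRepTorsion_eq W ℓ e Φ he τ,
    modPCyclotomicCharacterZMod_eq_modNCyclotomicCharacter, hτa]

end WeierstrassCurve

namespace Literature.NumberTheory.EllipticCurves

open _root_.WeierstrassCurve Rat.HeightOneSpectrum

/-- **Serre 1972, §4.2, Théorème 2 over `ℚ` (`serre_open_image`), from the local input of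
§1.11 for globally minimal curves and the density `0` of the supersingular primes.**  Granted
(`hF`) the structure of `E[ℓ]` as a module over the inertia groups above a prime `ℓ` of good
reduction for every elliptic curve over `ℚ` in global minimal form (Serre 1972, §1.11, Prop. 11
with Cor. — ordinary reduction: a line `X = 𝔽_ℓ v₀` with `I` trivial on `E[ℓ]/X` and `χ_X` onto
`𝔽_ℓˣ` — and Prop. 12 c) — supersingular reduction: the image of `I` is cyclic of order `ℓ² - 1`),
and (`hD`) the named fact `serre_supersingular_density_zero`, the mod-`ℓ` Galois representation
of every elliptic curve over `ℚ` without complex multiplication is onto for all large `ℓ`.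
Proof: `serre_open_image_minimal_of_inertia_shape` for a global minimal model `C • W`
(`hasGlobalMinimalModel_rat_holds`), transported back along `E ≅ C • E`.
[cite: Serre1972, §4.2, Théorème 2] -/
theorem serre_open_image_of_inertia_shape (hD : serre_supersingular_density_zero)
    (hF : ∀ (W : WeierstrassCurve ℚ) [W.IsElliptic] [W.IsGloballyMinimal] (ℓ : ℕ) [Fact ℓ.Prime],
      W.HasGoodReductionAtPrime ℓ →
      ∀ v : HeightOneSpectrum (𝓞 ℚ), (primesEquiv v : ℕ) = ℓ → ∀ 𝔏 ∈ v.primesAbove,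
        (letI : Module (ZMod ℓ) (geomTorsion W ℓ) := AddSubgroup.torsionBy.zmodModule
         ∃ v₀ : geomTorsion W ℓ, v₀ ≠ 0 ∧
           (∀ τ ∈ 𝔏.inertia (absoluteGaloisGroup ℚ), ∀ x : geomTorsion W ℓ,
              ∃ b : ZMod ℓ, τ • x - x = b • v₀) ∧
           (∀ a : (ZMod ℓ)ˣ, ∃ τ ∈ 𝔏.inertia (absoluteGaloisGroup ℚ),
              τ • v₀ = (a : ZMod ℓ) • v₀)) ∨
        (IsCyclic ((𝔏.inertia (absoluteGaloisGroup ℚ)).map (galoisRepTorsion W ℓ)) ∧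
          Nat.card ((𝔏.inertia (absoluteGaloisGroup ℚ)).map (galoisRepTorsion W ℓ)) =
            ℓ ^ 2 - 1)) :
    serre_open_image := by
  intro W _ hCM
  -- a global minimal model `C • W`
  obtain ⟨C, hC⟩ := hasGlobalMinimalModel_rat_holds W
  haveI := hC
  -- no CM is preserved
  have hCM' : ¬ (C • W).HasCM := fun h ↦ hCM
    (HasCM.of_variableChange_baseChange (W₁ := W) (W₂ := C • W)
      (C.map (algebraMap ℚ (AlgebraicClosure ℚ))) (map_variableChange W C _) h)
  obtain ⟨p₀, hp₀⟩ := serre_open_image_minimal_of_inertia_shape hD hF (C • W) hCM'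
  refine ⟨p₀, fun p hp hle ↦ ?_⟩
  exact hasSurjectiveModNGaloisRep_of_isogeny_bijective (VariableChange.toIsogeny W C)
    ⟨VariableChange.toIsogeny_injective W C, VariableChange.toIsogeny_surjective W C⟩ p
    (hp₀ p hp hle)

/-- **Serre's open image theorem over `ℚ` (`serre_open_image`) from the reduction shape of `E[ℓ]`
at the good primes `ℓ` and the density `0` of the supersingular primes — final form.**  The local
hypothesis `hF` asks, for every elliptic curve over `ℚ` in global minimal form, every prime `ℓ`
of good reduction and every prime `𝔏` of `\bar ℤ` above `ℓ` with inertia group `I = I_𝔏`: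
*either* (ordinary reduction) a non-zero `v₀ ∈ E[ℓ]` with `τ x - x ∈ 𝔽_ℓ v₀` for all `τ ∈ I`,
`x ∈ E[ℓ]` — Serre 1972, §1.11 (1): the kernel `X_ℓ = 𝔽_ℓ v₀` of the reduction
`E_ℓ → Ẽ_ℓ`, the inertia group acting trivially on `Ẽ_ℓ` — *or* (supersingular reduction) that
the image of `I` in `Aut(E[ℓ])` is cyclic of order `ℓ² - 1` (§1.11, Prop. 12 c)).  The
surjectivity of `χ_X` (Prop. 11, Cor. (a)) is supplied by
`exists_mem_inertia_smul_eq_of_sub_mem_line`; the rest is `serre_open_image_of_inertia_shape`.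
[cite: Serre1972, §4.2, Théorème 2; §1.11, Prop. 11, Prop. 12] -/
theorem serre_open_image_of_reduction_shape (hD : serre_supersingular_density_zero)
    (hF : ∀ (W : WeierstrassCurve ℚ) [W.IsElliptic] [W.IsGloballyMinimal] (ℓ : ℕ) [Fact ℓ.Prime],
      W.HasGoodReductionAtPrime ℓ →
      ∀ v : HeightOneSpectrum (𝓞 ℚ), (primesEquiv v : ℕ) = ℓ → ∀ 𝔏 ∈ v.primesAbove,
        (letI : Module (ZMod ℓ) (geomTorsion W ℓ) := AddSubgroup.torsionBy.zmodModule
         ∃ v₀ : geomTorsion W ℓ, v₀ ≠ 0 ∧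
           ∀ τ ∈ 𝔏.inertia (absoluteGaloisGroup ℚ), ∀ x : geomTorsion W ℓ,
              ∃ b : ZMod ℓ, τ • x - x = b • v₀) ∨
        (IsCyclic ((𝔏.inertia (absoluteGaloisGroup ℚ)).map (galoisRepTorsion W ℓ)) ∧
          Nat.card ((𝔏.inertia (absoluteGaloisGroup ℚ)).map (galoisRepTorsion W ℓ)) =
            ℓ ^ 2 - 1)) :
    serre_open_image := by
  refine serre_open_image_of_inertia_shape hD fun W _ _ ℓ _ hgood v hv 𝔏 h𝔏 ↦ ?_
  rcases hF W ℓ hgood v hv 𝔏 h𝔏 with ⟨v₀, hv₀, hquot⟩ | h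
  · exact Or.inl ⟨v₀, hv₀, hquot,
      fun a ↦ W.exists_mem_inertia_smul_eq_of_sub_mem_line ℓ hv h𝔏 hv₀ hquot a⟩
  · exact Or.inr h

end Literature.NumberTheory.EllipticCurves
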